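import Summits.HodgeConjecture.CorCM.Census.CentralSquaresOrbitCorner
import Summits.HodgeConjecture.CorCM.Census.CentralSquaresMixedFaceCoords

/-!
# The square-central class, XLI: the MIXED designated face at general `m` — the `T₁`-defect of `Φ = {T ∣ A}` and `Y_h − Y'_{h·g₁⁻¹} ∈ L`

COR-CM (cell `pub-hodgecm2`), count-neutral kernel combinatorics by the binder seat b09 (gen 48; lane SQUARE-CENTRAL CLASS, part XLI), on part XXXIV
(`single_sub_thetaG_mem_orbit_corner_of_face`: the FORCING form of the orbit-corner star normal form, in the exchanged frame `(T₁; T₀)` and in the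
companion frame `(T₀; T̄₁)`), parts V/VI/VII (`base_cases_exchange`, `card_frame`, `card_sdiff_frame`, `cover_frame`, `sdiff_eq_of_dev`, `companion_base`,
`companion_card`), part XXVI (`sdiff_T₁_pair_type`), part XXVII (`thetaG_typeSum_oflipCM_of_not_mem`), part II (`dev_compl`) and gen 31ʼs transport
`mapDomain_rt_thetaG`, BY NAME.  Theorems only: no definition, no `decide`, no certificate, no named fact, no `sorry`.  HONEST FRAMING: `HC_CM` is NOT
proved, here or anywhere in the tree; nothing here is a period or a headline.

THE CYCLIC-KERNEL ROWS (design note `CYCLIC-KERNEL.md`, gen 48): dihedral quotients `π : G ↠ D₄` whose kernel is cyclic and generated by the square of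
a reflection lift — for `|ker π| = 2` the order-`4` swap rows of part XXXII (`ℤ/4 ⋊ ℤ/4`), for `|ker π| = 4` the last two open rows of order `32`
(`ℤ/4 ⋊ ℤ/8` with `c = ρ²` or `c = ρ²q⁴`: EVERY reflection lift of order `8`, the place permutation of the swap an `8`-cycle, no `Q`-stable top type).
Parts XXVI–XXVII did the case `m = 2` with the corners spelled out element by element; this file is the SAME mechanism at every `m ≥ 2`, the corners
being orbit corners of part XXXIV.  Frame `(T₀; T₁)`, `|T₀| = 4m`, `𝓗 = T₀ ∖ T₁` of size `2m`; `T ⊆ 𝓗` and `A ⊆ 𝓗ᶜ = T₀ ∩ T₁` of size `m` each;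
`Φ = {T ∣ A}` (deviation set `T ∪ A`, a four-way tie at distance `2m`); the DESIGNATED FACE is the MIXED face of `Φ` at the places of `k ∈ A` and
`h ∈ 𝓗 ∖ T` (lowering toward `T₁`).  Its corners: the mixed corner `Φ^{(k)(h)}` (unique nearest base change `T₁`: in the frame `(T₁; T₀)` its
deviation set is `c·(𝓗 ∖ T ∖ h) ∪ (A ∖ k)`, strictly below the orbit corner `{c·(𝓗 ∖ T) ∣ A ∖ k} = Φ^{(k)}`), the `T₀/T₁` tie `Φ^{(k)}` and the `T̄₀/T₁`
tie `Φ^{(h)}` (whose complement `c·Φ^{(h)} = {𝓗ᶜ ∖ A ∣ 𝓗 ∖ T ∖ h}` is an orbit corner of the companion frame `(T₀; T̄₁)`).  PRESCRIBED (part XIIIʼs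
chosen cover; both are strict): the face of `Φ^{(k)}` at two places of `𝓗 ∖ T` (toward `T₁`) and the face of `Φ^{(h)}` at two places of `𝓗ᶜ ∖ A`
(toward `T̄₀`).

* §1 **`defect_T₁_mixed_face'`** (`m ≥ 2`): `[Φ] − θ_{T₁}(typeSum [Φ]) − (θ_{T̄₀} − θ_{T₁})(typeSum [Φ^{(h)}]) ∈ L`.
* §2 **`mixed_face_stabiliser_relation'`**, **`stabiliser_relation_coords'`**, **`Y_sub_Y'_mem_of_mixed_face'`**: for `g₁` stabilising `T₀` and
  `Φ` with `T₁·g₁⁻¹ = T̄₁`, the near relation `W` and its coordinate form `Y_h − Y'_{h·g₁⁻¹} ∈ L` (pairs in `L`) — the proofs of parts XXVI §3 and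
  XXVII §2 verbatim on top of §1.

## References
* [Pohlmann1968] H. Pohlmann, Algebraic cycles on abelian varieties of complex multiplication type, Ann. of Math. 88 (1968), Thm 1.
* [Milne1999] J. S. Milne, Lefschetz motives and the Tate conjecture, Compositio Math. 117 (1999), Prop. 2.1, p. 54.
-/

namespace Summit.HodgeConjecture.CorCM.Census.CentralSquares

open Finset
open scoped symmDiff
open Summit.HodgeConjecture.CorCM.Prior.AllgGroup.RfwfAllgGroup
open Summit.HodgeConjecture.CorCM.Census.BlockParity
open Summit.HodgeConjecture.CorCM.Census.Coinvariant
open Summit.HodgeConjecture.CorCM.Census.TwistGeneration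
open Summit.HodgeConjecture.CorCM.Census.BaseBlock
open Summit.HodgeConjecture.CorCM.Census.CoverClosure

noncomputable section

variable {G : Type*} [Group G] [Fintype G] [DecidableEq G] (c : G)

section Frame

variable (hc2 : c * c = 1) (hcen : ∀ x : G, x * c = c * x) (T₀ T₁ : CMF G c)
variable (hbase : ∀ Q : G, rt c Q T₀ = T₀ ∨ rt c Q T₀ = rt c c T₀ ∨ rt c Q T₀ = T₁ ∨ rt c Q T₀ = rt c c T₁)
variable (m : ℕ) (hn : T₀.1.card = 4 * m) (hH : (T₀.1 \ T₁.1).card = 2 * m)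
variable (Q : G) (hQ : rt c Q T₀ = T₁)
variable (L : Submodule ℤ (CMF G c →₀ ℤ)) (hLrt : ∀ (Q' : G) (y : CMF G c →₀ ℤ), y ∈ L → Finsupp.mapDomain (rt c Q') y ∈ L)
variable (hcover : ∀ Ψ : CMF G c, 2 ≤ bpot c T₀ Ψ → ∃ Q₂ s s' : G, bpot c T₀ Ψ = ddist (rt c Q₂ T₀) Ψ ∧
    s ∈ (rt c Q₂ T₀).1 \ Ψ.1 ∧ s' ∈ (rt c Q₂ T₀).1 \ Ψ.1 ∧ s ≠ s' ∧
    gface c hc2 Ψ s s' ∈ L ∧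
    ((∃ Q₁ t t' : G, bpot c T₀ Ψ = ddist (rt c Q₁ T₀) Ψ ∧ t ∈ (rt c Q₁ T₀).1 \ Ψ.1 ∧ t' ∈ (rt c Q₁ T₀).1 \ Ψ.1 ∧ t ≠ t' ∧
        (∀ Q' : G, ddist (rt c Q' T₀) (oflipCM c hc2 t Ψ) = bpot c T₀ (oflipCM c hc2 t Ψ) → rt c Q' T₀ = rt c Q₁ T₀) ∧
        (∀ Q' : G, ddist (rt c Q' T₀) (oflipCM c hc2 t' Ψ) = bpot c T₀ (oflipCM c hc2 t' Ψ) → rt c Q' T₀ = rt c Q₁ T₀) ∧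
        (∀ Q' : G, ddist (rt c Q' T₀) (oflipCM c hc2 t (oflipCM c hc2 t' Ψ)) = bpot c T₀ (oflipCM c hc2 t (oflipCM c hc2 t' Ψ)) →
          rt c Q' T₀ = rt c Q₁ T₀)) →
      (∀ Q' : G, ddist (rt c Q' T₀) (oflipCM c hc2 s Ψ) = bpot c T₀ (oflipCM c hc2 s Ψ) → rt c Q' T₀ = rt c Q₂ T₀) ∧
      (∀ Q' : G, ddist (rt c Q' T₀) (oflipCM c hc2 s' Ψ) = bpot c T₀ (oflipCM c hc2 s' Ψ) → rt c Q' T₀ = rt c Q₂ T₀) ∧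
      (∀ Q' : G, ddist (rt c Q' T₀) (oflipCM c hc2 s (oflipCM c hc2 s' Ψ)) = bpot c T₀ (oflipCM c hc2 s (oflipCM c hc2 s' Ψ)) →
        rt c Q' T₀ = rt c Q₂ T₀)))

/-! ## §1 The `T₁`-defect of the designated type at general `m` -/

include hcen hbase hn hH hQ hLrt hcover in
/-- **THE `T₁`-DEFECT OF THE DESIGNATED TYPE** (`m ≥ 2`).  `D(Φ) = T ∪ A` with `T ⊆ 𝓗`, `A ⊆ 𝓗ᶜ`, `|T| = |A| = m`; `k ∈ A`, `h ∈ 𝓗 ∖ T`.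
If `L` (base-change stable, fed by a strict lowering cover) contains the mixed face of `Φ` at the places of `k, h`, a face of `Φ^{(k)}` at two
places `h₁ ≠ h₂` of `𝓗 ∖ T` and a face of `Φ^{(h)}` at two places `k₁ ≠ k₂` of `𝓗ᶜ ∖ A`, then
`[Φ] − θ_{T₁}(typeSum [Φ]) − (θ_{T̄₀}(typeSum [Φ^{(h)}]) − θ_{T₁}(typeSum [Φ^{(h)}])) ∈ L`. [folklore] -/
theorem defect_T₁_mixed_face' (hm : 2 ≤ m) (T A : Finset G) (hTH : T ⊆ T₀.1 \ T₁.1) (hTm : T.card = m)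
    (hA : A ⊆ T₀.1 ∩ T₁.1) (hAm : A.card = m) (Φ : CMF G c) (hΦ : T₀.1 \ Φ.1 = T ∪ A)
    {k h : G} (hk : k ∈ A) (hh : h ∈ (T₀.1 \ T₁.1) \ T) (hF : gface c hc2 Φ k h ∈ L)
    {h₁ h₂ : G} (hh₁ : h₁ ∈ (T₀.1 \ T₁.1) \ T) (hh₂ : h₂ ∈ (T₀.1 \ T₁.1) \ T) (h₁₂ : h₁ ≠ h₂)
    (hFk : gface c hc2 (oflipCM c hc2 k Φ) h₁ h₂ ∈ L)
    {k₁ k₂ : G} (hk₁ : k₁ ∈ (T₀.1 ∩ T₁.1) \ A) (hk₂ : k₂ ∈ (T₀.1 ∩ T₁.1) \ A) (hk₁₂ : k₁ ≠ k₂)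
    (hFh : gface c hc2 (oflipCM c hc2 h Φ) k₁ k₂ ∈ L) :
    Finsupp.single Φ 1 - thetaG c hc2 T₁ (typeSum G c (Finsupp.single Φ 1)) -
      (thetaG c hc2 (rt c c T₀) (typeSum G c (Finsupp.single (oflipCM c hc2 h Φ) 1)) -
        thetaG c hc2 T₁ (typeSum G c (Finsupp.single (oflipCM c hc2 h Φ) 1))) ∈ L := by
  have hm1 : 1 ≤ m := by omega
  -- the elements
  have hAH : ∀ a ∈ A, a ∉ T₀.1 \ T₁.1 := fun a ha h' => (mem_sdiff.mp h').2 (mem_inter.mp (hA ha)).2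
  have hk0 : k ∈ T₀.1 := (mem_inter.mp (hA hk)).1
  have hk1 : k ∈ T₁.1 := (mem_inter.mp (hA hk)).2
  have hkΦ : k ∉ Φ.1 := by
    have h0 : k ∈ T₀.1 \ Φ.1 := by rw [hΦ]; exact mem_union_right _ hk
    exact (mem_sdiff.mp h0).2
  have hh0 : h ∈ T₀.1 := (mem_sdiff.mp (mem_sdiff.mp hh).1).1
  have hh1 : h ∉ T₁.1 := (mem_sdiff.mp (mem_sdiff.mp hh).1).2
  have hch1 : c * h ∈ T₁.1 := by by_contra hc'; exact hh1 ((T₁.2 h).mpr hc')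
  have hch0 : c * h ∉ T₀.1 := (T₀.2 h).mp hh0
  have hhΦ : h ∈ Φ.1 := by
    by_contra hc'
    have h0 : h ∈ T₀.1 \ Φ.1 := mem_sdiff.mpr ⟨hh0, hc'⟩
    rw [hΦ, mem_union] at h0
    rcases h0 with hT | hAm'
    · exact (mem_sdiff.mp hh).2 hT
    · exact hh1 (mem_inter.mp (hA hAm')).2
  have hchΦ : c * h ∉ Φ.1 := (Φ.2 h).mp hhΦ
  have hkch : k ≠ c * h := fun e => hch0 (e ▸ hk0)
  -- the exchanged frame `(T₁; T₀)`
  have hbase₁ := base_cases_exchange c hbase hQ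
  have hn₁ : T₁.1.card = 4 * m := card_frame c hc2 T₀ T₁ m hn
  have hH₁ : (T₁.1 \ T₀.1).card = 2 * m := by rw [card_sdiff_frame c hc2 T₀ T₁, hH]
  have hcover₁ := cover_frame c hc2 T₀ L Q hcover
  simp only [hQ] at hcover₁
  -- `T' = c·(𝓗 ∖ T)`, `B' = A ∖ k`: the orbit corner `Φ^{(k)} = {T' ∣ B'}` of the exchanged frame
  set T' := ((T₀.1 \ T₁.1) \ T).image (fun x => c * x) with hT'def
  have hT'H : T' ⊆ T₁.1 \ T₀.1 := by
    intro x hx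
    obtain ⟨u, hu, rfl⟩ := mem_image.mp hx
    obtain ⟨hu0, hu1⟩ := mem_sdiff.mp (mem_sdiff.mp hu).1
    exact mem_sdiff.mpr ⟨by by_contra h'; exact hu1 ((T₁.2 u).mpr h'), (T₀.2 u).mp hu0⟩
  have hT'm : T'.card = m := by
    rw [hT'def, card_image_of_injective _ (mul_right_injective c), card_sdiff_of_subset hTH, hH, hTm]; omega
  have hB' : A.erase k ⊆ T₁.1 \ (T₁.1 \ T₀.1) := by
    intro b hb
    have hbA := mem_of_mem_erase hb
    exact mem_sdiff.mpr ⟨(mem_inter.mp (hA hbA)).2, fun h' => (mem_sdiff.mp h').2 (mem_inter.mp (hA hbA)).1⟩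
  have hB'm : (A.erase k).card < m := by rw [card_erase_of_mem hk, hAm]; omega
  have hkT' : k ∉ T' := fun h' => (mem_sdiff.mp (hT'H h')).2 hk0
  have hD1 : T₁.1 \ Φ.1 = A ∪ T' := sdiff_T₁_pair_type c hc2 T₀ T₁ T A hTH hA Φ hΦ
  have hXk : T₁.1 \ (oflipCM c hc2 k Φ).1 = T' ∪ A.erase k := by
    rw [dev_oflip c hc2 hk1 hkΦ, hD1, erase_union_distrib, erase_eq_of_notMem hkT', union_comm]
  have hchT' : c * h ∈ T' := mem_image.mpr ⟨h, hh, rfl⟩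
  have hcornerT₁ := single_sub_thetaG_mem_orbit_corner_of_face c hc2 hcen T₁ T₀ hbase₁ m hn₁ hH₁ L hcover₁ T' (A.erase k) hT'H hT'm hB' hB'm
    (fun Y hY => by
      have hYX : Y = oflipCM c hc2 k Φ := eq_of_dev_eq c T₁ (by rw [hY, hXk])
      subst hYX
      refine ⟨c * h₁, c * h₂, mem_image.mpr ⟨h₁, hh₁, rfl⟩, mem_image.mpr ⟨h₂, hh₂, rfl⟩,
        fun e => h₁₂ (mul_right_injective c e), ?_⟩
      have e : gface c hc2 (oflipCM c hc2 k Φ) (c * h₁) (c * h₂) = gface c hc2 (oflipCM c hc2 k Φ) h₁ h₂ := by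
        unfold gface; simp only [oflipCM_cmul]
      rw [e]; exact hFk)
  -- (b) the mixed corner `Φ^{(k)(h)}`: strictly below `{T' ∣ B'}`
  have eH : oflipCM c hc2 h Φ = oflipCM c hc2 (c * h) Φ := (oflipCM_cmul c hc2 h Φ).symm
  have hkYh : k ∉ (oflipCM c hc2 h Φ).1 := by
    have h0 : k ∈ T₁.1 \ (oflipCM c hc2 h Φ).1 := by
      rw [eH, dev_oflip c hc2 hch1 hchΦ, mem_erase, hD1]; exact ⟨hkch, mem_union_left _ hk⟩
    exact (mem_sdiff.mp h0).2
  have hXkh : T₁.1 \ (oflipCM c hc2 k (oflipCM c hc2 h Φ)).1 = (T' ∪ A.erase k).erase (c * h) := by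
    rw [dev_oflip c hc2 hk1 hkYh, eH, dev_oflip c hc2 hch1 hchΦ, hD1, erase_right_comm, erase_union_distrib (s := A),
      erase_eq_of_notMem hkT', union_comm]
  have hb : Finsupp.single (oflipCM c hc2 k (oflipCM c hc2 h Φ)) 1 -
      thetaG c hc2 T₁ (typeSum G c (Finsupp.single (oflipCM c hc2 k (oflipCM c hc2 h Φ)) 1)) ∈ L :=
    hcornerT₁ _ ⟨by rw [hXkh]; exact erase_subset _ _, Or.inr fun h' => by rw [hXkh] at h'; exact (notMem_erase (c * h) _) (h' hchT')⟩
  -- (c) the tie corner `Φ^{(k)}` toward `T₁`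
  have hc' : Finsupp.single (oflipCM c hc2 k Φ) 1 - thetaG c hc2 T₁ (typeSum G c (Finsupp.single (oflipCM c hc2 k Φ) 1)) ∈ L :=
    hcornerT₁ _ ⟨by rw [hXk], Or.inl hXk⟩
  -- (d) the tie corner `Φ^{(h)}` toward `T̄₀`: its complement is the orbit corner `{𝓗ᶜ ∖ A ∣ 𝓗 ∖ T ∖ h}` of the companion frame `(T₀; T̄₁)`
  have hbase₂ := companion_base c hc2 T₀ T₁ hbase
  have hH₂ : (T₀.1 \ (rt c c T₁).1).card = 2 * m := companion_card c hcen T₀ T₁ m hn hH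
  set T'' := (T₀.1 ∩ T₁.1) \ A with hT''def
  set B'' := ((T₀.1 \ T₁.1) \ T).erase h with hB''def
  have hI : T₀.1 ∩ T₁.1 = T₀.1 \ (rt c c T₁).1 := by
    ext x; simp only [mem_inter, mem_sdiff, mem_compl_type_iff c hcen T₁, not_not]
  have hT''H : T'' ⊆ T₀.1 \ (rt c c T₁).1 := fun x hx => hI ▸ (mem_sdiff.mp hx).1
  have hIcard : (T₀.1 ∩ T₁.1).card = 2 * m := by rw [hI]; exact hH₂
  have hT''m : T''.card = m := by
    rw [hT''def, card_sdiff_of_subset hA, hIcard, hAm]; omega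
  have hB'' : B'' ⊆ T₀.1 \ (T₀.1 \ (rt c c T₁).1) := by
    intro x hx
    have hx' := (mem_sdiff.mp (mem_of_mem_erase hx)).1
    refine mem_sdiff.mpr ⟨(mem_sdiff.mp hx').1, fun h' => ?_⟩
    rw [← hI] at h'
    exact (mem_sdiff.mp hx').2 (mem_inter.mp h').2
  have hB''m : B''.card < m := by
    rw [hB''def, card_erase_of_mem hh, card_sdiff_of_subset hTH, hH, hTm]; omega
  have hXc : T₀.1 \ (rt c c (oflipCM c hc2 h Φ)).1 = T'' ∪ B'' := by
    rw [dev_compl c hcen, dev_oflip_of_mem c hc2 hh0 hhΦ, hΦ]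
    ext x
    simp only [hT''def, hB''def, mem_sdiff, mem_insert, mem_union, mem_inter, mem_erase, not_or]
    constructor
    · rintro ⟨hx0, hxh, hxT, hxA⟩
      by_cases hx1 : x ∈ T₁.1
      · exact Or.inl ⟨⟨hx0, hx1⟩, hxA⟩
      · exact Or.inr ⟨hxh, ⟨hx0, hx1⟩, hxT⟩
    · rintro (⟨⟨hx0, hx1⟩, hxA⟩ | ⟨hxh, ⟨hx0, hx1⟩, hxT⟩)
      · refine ⟨hx0, ?_, fun hxT => (mem_sdiff.mp (hTH hxT)).2 hx1, hxA⟩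
        rintro rfl; exact hh1 hx1
      · exact ⟨hx0, hxh, hxT, fun hxA => hx1 (mem_inter.mp (hA hxA)).2⟩
  have hcinv : c⁻¹ = c := inv_eq_of_mul_eq_one_right hc2
  have hface'' : gface c hc2 (rt c c (oflipCM c hc2 h Φ)) k₁ k₂ ∈ L := by
    have h1 := hLrt c _ hFh
    rw [mapDomain_rt_gface, hcinv, hcen k₁, hcen k₂] at h1
    have e : gface c hc2 (rt c c (oflipCM c hc2 h Φ)) (c * k₁) (c * k₂) = gface c hc2 (rt c c (oflipCM c hc2 h Φ)) k₁ k₂ := by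
      unfold gface; simp only [oflipCM_cmul]
    rw [← e]; exact h1
  have hd0 : Finsupp.single (rt c c (oflipCM c hc2 h Φ)) 1 -
      thetaG c hc2 T₀ (typeSum G c (Finsupp.single (rt c c (oflipCM c hc2 h Φ)) 1)) ∈ L :=
    single_sub_thetaG_mem_orbit_corner_of_face c hc2 hcen T₀ (rt c c T₁) hbase₂ m hn hH₂ L hcover T'' B'' hT''H hT''m hB'' hB''m
      (fun Y hY => by
        have hYX : Y = rt c c (oflipCM c hc2 h Φ) := eq_of_dev_eq c T₀ (by rw [hY, hXc])
        subst hYX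
        exact ⟨k₁, k₂, hk₁, hk₂, hk₁₂, hface''⟩)
      _ ⟨by rw [hXc], Or.inl hXc⟩
  have hd : Finsupp.single (oflipCM c hc2 h Φ) 1 -
      thetaG c hc2 (rt c c T₀) (typeSum G c (Finsupp.single (oflipCM c hc2 h Φ) 1)) ∈ L := by
    have h1 := hLrt c _ hd0
    rw [Finsupp.mapDomain_sub, Finsupp.mapDomain_single, mapDomain_rt_thetaG, ← rt_mul, hc2, rt_one] at h1
    exact h1
  -- (e) assemble: the face identity and `typeSum (face) = 0`
  have hnot : h ∉ orb c k := by
    rw [mem_orb]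
    rintro (rfl | rfl)
    · exact hh1 hk1
    · exact hch0 (by rw [← mul_assoc, hc2, one_mul]; exact hk0)
  have hθ : thetaG c hc2 T₁ (typeSum G c (gface c hc2 Φ k h)) = 0 := by rw [typeSum_gface c hc2 Φ hnot, map_zero]
  have e : Finsupp.single Φ 1 - thetaG c hc2 T₁ (typeSum G c (Finsupp.single Φ 1)) -
      (thetaG c hc2 (rt c c T₀) (typeSum G c (Finsupp.single (oflipCM c hc2 h Φ) 1)) -
        thetaG c hc2 T₁ (typeSum G c (Finsupp.single (oflipCM c hc2 h Φ) 1))) =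
      gface c hc2 Φ k h -
        (Finsupp.single (oflipCM c hc2 k (oflipCM c hc2 h Φ)) 1 -
          thetaG c hc2 T₁ (typeSum G c (Finsupp.single (oflipCM c hc2 k (oflipCM c hc2 h Φ)) 1))) +
        (Finsupp.single (oflipCM c hc2 k Φ) 1 - thetaG c hc2 T₁ (typeSum G c (Finsupp.single (oflipCM c hc2 k Φ) 1))) +
        (Finsupp.single (oflipCM c hc2 h Φ) 1 - thetaG c hc2 (rt c c T₀) (typeSum G c (Finsupp.single (oflipCM c hc2 h Φ) 1))) -
        thetaG c hc2 T₁ (typeSum G c (gface c hc2 Φ k h)) := by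
    simp only [gface, map_add, map_sub]; abel
  rw [e, hθ, sub_zero]
  exact Submodule.add_mem _ (Submodule.add_mem _ (Submodule.sub_mem _ hF hb) hc') hd

/-! ## §2 The stabiliser relation and its coordinate form `Y_h − Y'_{h·g₁⁻¹} ∈ L` -/

include hcen hbase hn hH hQ hLrt hcover in
/-- **THE STABILISER RELATION OF THE DESIGNATED TYPE** (`m ≥ 2`).  In the situation of `defect_T₁_mixed_face'`, let `g₁` stabilise `T₀` and `Φ` and
carry `T₁` to `T̄₁`.  Then `(θ_{T̄₁} − θ_{T₁})(typeSum [Φ]) − (θ_{T̄₀} − θ_{T₁})(typeSum [Φ^{(h)}]) + (θ_{T̄₀} − θ_{T̄₁})(typeSum [Φ^{(h·g₁⁻¹)}]) ∈ L`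
(the `T₁`-defect of `Φ` minus its translate by `g₁`; part XXVI §3 verbatim). [folklore] -/
theorem mixed_face_stabiliser_relation' (hm : 2 ≤ m) (T A : Finset G) (hTH : T ⊆ T₀.1 \ T₁.1) (hTm : T.card = m)
    (hA : A ⊆ T₀.1 ∩ T₁.1) (hAm : A.card = m) (Φ : CMF G c) (hΦ : T₀.1 \ Φ.1 = T ∪ A)
    {k h : G} (hk : k ∈ A) (hh : h ∈ (T₀.1 \ T₁.1) \ T) (hF : gface c hc2 Φ k h ∈ L)
    {h₁ h₂ : G} (hh₁ : h₁ ∈ (T₀.1 \ T₁.1) \ T) (hh₂ : h₂ ∈ (T₀.1 \ T₁.1) \ T) (h₁₂ : h₁ ≠ h₂)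
    (hFk : gface c hc2 (oflipCM c hc2 k Φ) h₁ h₂ ∈ L)
    {k₁ k₂ : G} (hk₁ : k₁ ∈ (T₀.1 ∩ T₁.1) \ A) (hk₂ : k₂ ∈ (T₀.1 ∩ T₁.1) \ A) (hk₁₂ : k₁ ≠ k₂)
    (hFh : gface c hc2 (oflipCM c hc2 h Φ) k₁ k₂ ∈ L)
    (g₁ : G) (hg₀ : rt c g₁ T₀ = T₀) (hg₁ : rt c g₁ T₁ = rt c c T₁) (hgΦ : rt c g₁ Φ = Φ) :
    (thetaG c hc2 (rt c c T₁) (typeSum G c (Finsupp.single Φ 1)) - thetaG c hc2 T₁ (typeSum G c (Finsupp.single Φ 1))) -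
      (thetaG c hc2 (rt c c T₀) (typeSum G c (Finsupp.single (oflipCM c hc2 h Φ) 1)) -
        thetaG c hc2 T₁ (typeSum G c (Finsupp.single (oflipCM c hc2 h Φ) 1))) +
      (thetaG c hc2 (rt c c T₀) (typeSum G c (Finsupp.single (oflipCM c hc2 (h * g₁⁻¹) Φ) 1)) -
        thetaG c hc2 (rt c c T₁) (typeSum G c (Finsupp.single (oflipCM c hc2 (h * g₁⁻¹) Φ) 1))) ∈ L := by
  have hv := defect_T₁_mixed_face' c hc2 hcen T₀ T₁ hbase m hn hH Q hQ L hLrt hcover hm T A hTH hTm hA hAm Φ hΦ hk hh hF hh₁ hh₂ h₁₂ hFk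
    hk₁ hk₂ hk₁₂ hFh
  have hgc : rt c g₁ (rt c c T₀) = rt c c T₀ := by rw [← rt_mul, hcen g₁, rt_mul, hg₀]
  have hw := hLrt g₁ _ hv
  simp only [Finsupp.mapDomain_sub, Finsupp.mapDomain_single, mapDomain_rt_thetaG, rt_oflipCM, hgΦ, hg₁, hgc] at hw
  have e : (thetaG c hc2 (rt c c T₁) (typeSum G c (Finsupp.single Φ 1)) - thetaG c hc2 T₁ (typeSum G c (Finsupp.single Φ 1))) -
      (thetaG c hc2 (rt c c T₀) (typeSum G c (Finsupp.single (oflipCM c hc2 h Φ) 1)) -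
        thetaG c hc2 T₁ (typeSum G c (Finsupp.single (oflipCM c hc2 h Φ) 1))) +
      (thetaG c hc2 (rt c c T₀) (typeSum G c (Finsupp.single (oflipCM c hc2 (h * g₁⁻¹) Φ) 1)) -
        thetaG c hc2 (rt c c T₁) (typeSum G c (Finsupp.single (oflipCM c hc2 (h * g₁⁻¹) Φ) 1))) =
      (Finsupp.single Φ 1 - thetaG c hc2 T₁ (typeSum G c (Finsupp.single Φ 1)) -
        (thetaG c hc2 (rt c c T₀) (typeSum G c (Finsupp.single (oflipCM c hc2 h Φ) 1)) -
          thetaG c hc2 T₁ (typeSum G c (Finsupp.single (oflipCM c hc2 h Φ) 1)))) -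
      (Finsupp.single Φ 1 - thetaG c hc2 (rt c c T₁) (typeSum G c (Finsupp.single Φ 1)) -
        (thetaG c hc2 (rt c c T₀) (typeSum G c (Finsupp.single (oflipCM c hc2 (h * g₁⁻¹) Φ) 1)) -
          thetaG c hc2 (rt c c T₁) (typeSum G c (Finsupp.single (oflipCM c hc2 (h * g₁⁻¹) Φ) 1)))) := by
    abel
  rw [e]
  exact Submodule.sub_mem _ hv hw

include hcen hbase hn hH hQ hLrt hcover in
/-- **THE STABILISER RELATION IN COORDINATES** (`m ≥ 2`; `κ = h·g₁⁻¹`):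
`W = ((f_κ − e₀) − (g_κ − e₁)) − ((f_h − e₀) + (g_h − e₁)) + pair(T₀^{(h)}) − pair(T₀^{(κ)}) + pair(T₁^{(κ)}) − pair(T₁)` lies in `L` — four flips at
deviation places of `Φ`, all star forms of `Φ` cancel (part XXVII §2 verbatim). [folklore] -/
theorem stabiliser_relation_coords' (hm : 2 ≤ m) (T A : Finset G) (hTH : T ⊆ T₀.1 \ T₁.1) (hTm : T.card = m)
    (hA : A ⊆ T₀.1 ∩ T₁.1) (hAm : A.card = m) (Φ : CMF G c) (hΦ : T₀.1 \ Φ.1 = T ∪ A)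
    {k h : G} (hk : k ∈ A) (hh : h ∈ (T₀.1 \ T₁.1) \ T) (hF : gface c hc2 Φ k h ∈ L)
    {h₁ h₂ : G} (hh₁ : h₁ ∈ (T₀.1 \ T₁.1) \ T) (hh₂ : h₂ ∈ (T₀.1 \ T₁.1) \ T) (h₁₂ : h₁ ≠ h₂)
    (hFk : gface c hc2 (oflipCM c hc2 k Φ) h₁ h₂ ∈ L)
    {k₁ k₂ : G} (hk₁ : k₁ ∈ (T₀.1 ∩ T₁.1) \ A) (hk₂ : k₂ ∈ (T₀.1 ∩ T₁.1) \ A) (hk₁₂ : k₁ ≠ k₂)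
    (hFh : gface c hc2 (oflipCM c hc2 h Φ) k₁ k₂ ∈ L)
    (g₁ : G) (hg₀ : rt c g₁ T₀ = T₀) (hg₁ : rt c g₁ T₁ = rt c c T₁) (hgΦ : rt c g₁ Φ = Φ) :
    ((Finsupp.single (oflipCM c hc2 (h * g₁⁻¹) T₀) (1 : ℤ) - Finsupp.single T₀ 1) -
        (Finsupp.single (oflipCM c hc2 (h * g₁⁻¹) T₁) (1 : ℤ) - Finsupp.single T₁ 1)) -
      ((Finsupp.single (oflipCM c hc2 h T₀) (1 : ℤ) - Finsupp.single T₀ 1) + (Finsupp.single (oflipCM c hc2 h T₁) (1 : ℤ) - Finsupp.single T₁ 1)) +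
      (pair c (oflipCM c hc2 h T₀) - pair c (oflipCM c hc2 (h * g₁⁻¹) T₀) + pair c (oflipCM c hc2 (h * g₁⁻¹) T₁) - pair c T₁) ∈ L := by
  have hW := mixed_face_stabiliser_relation' c hc2 hcen T₀ T₁ hbase m hn hH Q hQ L hLrt hcover hm T A hTH hTm hA hAm Φ hΦ hk hh hF hh₁ hh₂ h₁₂
    hFk hk₁ hk₂ hk₁₂ hFh g₁ hg₀ hg₁ hgΦ
  -- the places
  have hh0 : h ∈ T₀.1 := (mem_sdiff.mp (mem_sdiff.mp hh).1).1
  have hh1 : h ∉ T₁.1 := (mem_sdiff.mp (mem_sdiff.mp hh).1).2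
  have hhΦ : h ∈ Φ.1 := by
    by_contra hc'
    have h0 : h ∈ T₀.1 \ Φ.1 := mem_sdiff.mpr ⟨hh0, hc'⟩
    rw [hΦ, mem_union] at h0
    rcases h0 with hT | hAm'
    · exact (mem_sdiff.mp hh).2 hT
    · exact hh1 (mem_inter.mp (hA hAm')).2
  have hch1 : c * h ∈ T₁.1 := by by_contra hc'; exact hh1 ((T₁.2 h).mpr hc')
  have hch0 : c * h ∉ T₀.1 := (T₀.2 h).mp hh0
  have hchΦ : c * h ∉ Φ.1 := (Φ.2 h).mp hhΦ
  have hch0c : c * h ∈ (rt c c T₀).1 := (mem_compl_type_iff c hcen T₀ (c * h)).mpr hch0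
  have hκ0 : h * g₁⁻¹ ∈ T₀.1 := by
    have e : h * g₁⁻¹ ∈ (rt c g₁ T₀).1 := by rw [mem_rt, inv_mul_cancel_right]; exact hh0
    rwa [hg₀] at e
  have hκΦ : h * g₁⁻¹ ∈ Φ.1 := by
    have e : h * g₁⁻¹ ∈ (rt c g₁ Φ).1 := by rw [mem_rt, inv_mul_cancel_right]; exact hhΦ
    rwa [hgΦ] at e
  have hκ1 : h * g₁⁻¹ ∈ T₁.1 := by
    by_contra hc'
    have e : h * g₁⁻¹ ∈ (rt c c T₁).1 := (mem_compl_type_iff c hcen T₁ _).mpr hc'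
    rw [← hg₁, mem_rt, inv_mul_cancel_right] at e
    exact hh1 e
  have hcκ0 : c * (h * g₁⁻¹) ∉ T₀.1 := (T₀.2 _).mp hκ0
  have hcκ1 : c * (h * g₁⁻¹) ∉ T₁.1 := (T₁.2 _).mp hκ1
  have hcκΦ : c * (h * g₁⁻¹) ∉ Φ.1 := (Φ.2 _).mp hκΦ
  have hcκ0c : c * (h * g₁⁻¹) ∈ (rt c c T₀).1 := (mem_compl_type_iff c hcen T₀ _).mpr hcκ0
  have hcκ1c : c * (h * g₁⁻¹) ∈ (rt c c T₁).1 := (mem_compl_type_iff c hcen T₁ _).mpr hcκ1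
  -- the four flips, each at a deviation place of `Φ` for the base type in question
  have e1 : oflipCM c hc2 h Φ = oflipCM c hc2 (c * h) Φ := (oflipCM_cmul c hc2 h Φ).symm
  have e2 : oflipCM c hc2 (h * g₁⁻¹) Φ = oflipCM c hc2 (c * (h * g₁⁻¹)) Φ := (oflipCM_cmul c hc2 _ Φ).symm
  have hsr : ∀ X : CMF G c, Finsupp.single (rt c c X) (1 : ℤ) = pair c X - Finsupp.single X 1 := fun X => by
    rw [pair, add_sub_cancel_left]
  rw [e1, thetaG_typeSum_oflipCM_of_not_mem c hc2 T₁ Φ hch1 hchΦ, thetaG_typeSum_oflipCM_of_not_mem c hc2 (rt c c T₀) Φ hch0c hchΦ,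
    e2, thetaG_typeSum_oflipCM_of_not_mem c hc2 (rt c c T₀) Φ hcκ0c hcκΦ,
    thetaG_typeSum_oflipCM_of_not_mem c hc2 (rt c c T₁) Φ hcκ1c hcκΦ] at hW
  simp only [oflipCM_cmul, oflipCM_rt_self c hc2 hcen, hsr] at hW
  have e : ((Finsupp.single (oflipCM c hc2 (h * g₁⁻¹) T₀) (1 : ℤ) - Finsupp.single T₀ 1) -
        (Finsupp.single (oflipCM c hc2 (h * g₁⁻¹) T₁) (1 : ℤ) - Finsupp.single T₁ 1)) -
      ((Finsupp.single (oflipCM c hc2 h T₀) (1 : ℤ) - Finsupp.single T₀ 1) + (Finsupp.single (oflipCM c hc2 h T₁) (1 : ℤ) - Finsupp.single T₁ 1)) +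
      (pair c (oflipCM c hc2 h T₀) - pair c (oflipCM c hc2 (h * g₁⁻¹) T₀) + pair c (oflipCM c hc2 (h * g₁⁻¹) T₁) - pair c T₁) =
      thetaG c hc2 (rt c c T₁) (typeSum G c (Finsupp.single Φ 1)) - thetaG c hc2 T₁ (typeSum G c (Finsupp.single Φ 1)) -
        (thetaG c hc2 (rt c c T₀) (typeSum G c (Finsupp.single Φ 1)) -
            (pair c (oflipCM c hc2 h T₀) - Finsupp.single (oflipCM c hc2 h T₀) 1 - (pair c T₀ - Finsupp.single T₀ 1)) -
          (thetaG c hc2 T₁ (typeSum G c (Finsupp.single Φ 1)) - (Finsupp.single (oflipCM c hc2 h T₁) 1 - Finsupp.single T₁ 1))) +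
        (thetaG c hc2 (rt c c T₀) (typeSum G c (Finsupp.single Φ 1)) -
            (pair c (oflipCM c hc2 (h * g₁⁻¹) T₀) - Finsupp.single (oflipCM c hc2 (h * g₁⁻¹) T₀) 1 - (pair c T₀ - Finsupp.single T₀ 1)) -
          (thetaG c hc2 (rt c c T₁) (typeSum G c (Finsupp.single Φ 1)) -
            (pair c (oflipCM c hc2 (h * g₁⁻¹) T₁) - Finsupp.single (oflipCM c hc2 (h * g₁⁻¹) T₁) 1 - (pair c T₁ - Finsupp.single T₁ 1)))) := by
    abel
  rw [e]
  exact hW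

include hcen hbase hn hH hQ hLrt hcover in
/-- **`Y_h − Y'_{h·g₁⁻¹} ∈ L`** (`m ≥ 2`, pairs in `L`): the ONE new near relation of the cyclic-kernel rows, from the mixed designated face of
`Φ = {T ∣ A}` at the places of `k, h`, the prescribed strict faces of its two tie corners, and an element `g₁` stabilising `T₀` and `Φ` and carrying `T₁`
to `T̄₁`: `((f_h − e₀) + (g_h − e₁)) − ((f_κ − e₀) − (g_κ − e₁)) ∈ L`, `κ = h·g₁⁻¹`. [folklore] -/
theorem Y_sub_Y'_mem_of_mixed_face' (hP : ∀ Ψ : CMF G c, pair c Ψ ∈ L) (hm : 2 ≤ m) (T A : Finset G) (hTH : T ⊆ T₀.1 \ T₁.1)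
    (hTm : T.card = m) (hA : A ⊆ T₀.1 ∩ T₁.1) (hAm : A.card = m) (Φ : CMF G c) (hΦ : T₀.1 \ Φ.1 = T ∪ A)
    {k h : G} (hk : k ∈ A) (hh : h ∈ (T₀.1 \ T₁.1) \ T) (hF : gface c hc2 Φ k h ∈ L)
    {h₁ h₂ : G} (hh₁ : h₁ ∈ (T₀.1 \ T₁.1) \ T) (hh₂ : h₂ ∈ (T₀.1 \ T₁.1) \ T) (h₁₂ : h₁ ≠ h₂)
    (hFk : gface c hc2 (oflipCM c hc2 k Φ) h₁ h₂ ∈ L)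
    {k₁ k₂ : G} (hk₁ : k₁ ∈ (T₀.1 ∩ T₁.1) \ A) (hk₂ : k₂ ∈ (T₀.1 ∩ T₁.1) \ A) (hk₁₂ : k₁ ≠ k₂)
    (hFh : gface c hc2 (oflipCM c hc2 h Φ) k₁ k₂ ∈ L)
    (g₁ : G) (hg₀ : rt c g₁ T₀ = T₀) (hg₁ : rt c g₁ T₁ = rt c c T₁) (hgΦ : rt c g₁ Φ = Φ) :
    ((Finsupp.single (oflipCM c hc2 h T₀) (1 : ℤ) - Finsupp.single T₀ 1) + (Finsupp.single (oflipCM c hc2 h T₁) (1 : ℤ) - Finsupp.single T₁ 1)) -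
      ((Finsupp.single (oflipCM c hc2 (h * g₁⁻¹) T₀) (1 : ℤ) - Finsupp.single T₀ 1) -
        (Finsupp.single (oflipCM c hc2 (h * g₁⁻¹) T₁) (1 : ℤ) - Finsupp.single T₁ 1)) ∈ L := by
  have hW := stabiliser_relation_coords' c hc2 hcen T₀ T₁ hbase m hn hH Q hQ L hLrt hcover hm T A hTH hTm hA hAm Φ hΦ hk hh hF hh₁ hh₂ h₁₂ hFk
    hk₁ hk₂ hk₁₂ hFh g₁ hg₀ hg₁ hgΦ
  have hpairs : pair c (oflipCM c hc2 h T₀) - pair c (oflipCM c hc2 (h * g₁⁻¹) T₀) + pair c (oflipCM c hc2 (h * g₁⁻¹) T₁) - pair c T₁ ∈ L :=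
    Submodule.sub_mem _ (Submodule.add_mem _ (Submodule.sub_mem _ (hP _) (hP _)) (hP _)) (hP _)
  have h2 := Submodule.sub_mem _ hpairs hW
  have e : ((Finsupp.single (oflipCM c hc2 h T₀) (1 : ℤ) - Finsupp.single T₀ 1) + (Finsupp.single (oflipCM c hc2 h T₁) (1 : ℤ) - Finsupp.single T₁ 1)) -
      ((Finsupp.single (oflipCM c hc2 (h * g₁⁻¹) T₀) (1 : ℤ) - Finsupp.single T₀ 1) -
        (Finsupp.single (oflipCM c hc2 (h * g₁⁻¹) T₁) (1 : ℤ) - Finsupp.single T₁ 1)) =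
      (pair c (oflipCM c hc2 h T₀) - pair c (oflipCM c hc2 (h * g₁⁻¹) T₀) + pair c (oflipCM c hc2 (h * g₁⁻¹) T₁) - pair c T₁) -
      (((Finsupp.single (oflipCM c hc2 (h * g₁⁻¹) T₀) (1 : ℤ) - Finsupp.single T₀ 1) -
          (Finsupp.single (oflipCM c hc2 (h * g₁⁻¹) T₁) (1 : ℤ) - Finsupp.single T₁ 1)) -
        ((Finsupp.single (oflipCM c hc2 h T₀) (1 : ℤ) - Finsupp.single T₀ 1) + (Finsupp.single (oflipCM c hc2 h T₁) (1 : ℤ) - Finsupp.single T₁ 1)) +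
        (pair c (oflipCM c hc2 h T₀) - pair c (oflipCM c hc2 (h * g₁⁻¹) T₀) + pair c (oflipCM c hc2 (h * g₁⁻¹) T₁) - pair c T₁)) := by
    abel
  rw [e]
  exact h2

end Frame

end

end Summit.HodgeConjecture.CorCM.Census.CentralSquares
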